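import Literature.AlgebraicGeometry.Frobenioids.ModelFrobenioidRestrictionFiberProduct
import HarnessLib

/-!
# Frobenioids I, §0 (p. 17): the categorical fibre product `C₁ ×_D C₂` is symmetric and FUNCTORIAL IN COMPATIBLE
# TRIPLES OF EQUIVALENCES `(Ψ₁ : C₁ ⥲ C₁, Θ : C₂ ⥲ C₂, Θ_B : D ⥲ D)` — bookkeeping for [IUTchI] Ex. 5.1 (iii)'s `†ℱ^⊚`

Mochizuki, *The geometry of Frobenioids I: the general theory*, Kyushu J. Math. **62** (2008) 293–400, §0
"Categories" p. 17 (the "categorical fiber product" `C₁ ×_D C₂` of `Φ₁ : C₁ → D`, `Φ₂ : C₂ → D`: objects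
`(A₁, A₂, α : Φ₁(A₁) ⥲ Φ₂(A₂))`, morphisms compatible pairs; "one verifies easily …") [cite: MochizukiFrdI2008, §0 p.17].

PROOF-ONLY companion of abc-iut's `CategoriesFactorization.lean` (`CFP`, `proj₁`, `proj₂`), `FiberProducts.lean`
(`CFP.isoMk`) and abc-iut-f-027's `ModelFrobenioidRestrictionFiberProduct.lean` (`CFP.exists_equivalence_precomp` /
`exists_equivalence_of_iso_left` / `exists_equivalence_postcomp`, all lying over the projections ON THE NOSE).
Cell abc-iut, seat abc-iut-w4-d109 gen 9 (row C53ILIFT; the L1 brick behind the `⊚` twin of [IUTchI] Cor. 5.3 (i):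
`†ℱ^⊚ = †ℱ^⊛ ×_{Base(†ℱ^⊛)} †𝒟^⊚` is abc-iut-L5-t1's `CFP 𝓕.toBase 𝓕.baseMor`):

* `CFP.exists_equivalence_swap` — `C₁ ×_D C₂ ⥲ C₂ ×_D C₁`, `(A₁, A₂, α) ↦ (A₂, A₁, α⁻¹)`, exchanging the two
  projections on the nose;
* `CFP.exists_equivalence_precomp_right` / `exists_equivalence_of_iso_right` — the second-corner twins of f-027's
  first-corner lemmas (by conjugating with the swap);
* **`CFP.exists_equivalence_of_compatible_triple`** — for equivalences `Ψ₁`, `Θ`, `Θ_B` with 2-cells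
  `Ψ₁ ⋙ Φ₁ ≅ Φ₁ ⋙ Θ_B`, `Θ ⋙ Φ₂ ≅ Φ₂ ⋙ Θ_B`, an equivalence `C₁ ×_D C₂ ⥲ C₁ ×_D C₂` lying over `Ψ₁` on the first
  projection and over `Θ` on the second, ON THE NOSE (five forward steps: post-compose with `Θ_B`, re-glue the two
  corners along the 2-cells, pre-compose with `Ψ₁` and `Θ`).

Pure category theory over landed files; 0 `def`, no instance, no notation; nothing here bears on [IUTchIII] Cor. 3.12.
-/

namespace Literature.AlgebraicGeometry.Frobenioids

open CategoryTheory

universe v₁ v₂ v₃ u₁ u₂ u₃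

namespace CFP

variable {C₁ : Type u₁} [Category.{v₁} C₁] {C₂ : Type u₂} [Category.{v₂} C₂] {D : Type u₃} [Category.{v₃} D]

/-! ### Symmetry -/

/-- **`C₁ ×_D C₂ ⥲ C₂ ×_D C₁`**: `(A₁, A₂, α) ↦ (A₂, A₁, α⁻¹)`, `(γ₁, γ₂) ↦ (γ₂, γ₁)` — an equivalence (indeed an
isomorphism of categories) exchanging the projections on the nose, in both directions. [cite: MochizukiFrdI2008, §0 p.17] -/
theorem exists_equivalence_swap (Φ₁ : C₁ ⥤ D) (Φ₂ : C₂ ⥤ D) :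
    ∃ e : CFP Φ₁ Φ₂ ≌ CFP Φ₂ Φ₁,
      e.functor ⋙ proj₁ Φ₂ Φ₁ = proj₂ Φ₁ Φ₂ ∧ e.functor ⋙ proj₂ Φ₂ Φ₁ = proj₁ Φ₁ Φ₂ ∧
      e.inverse ⋙ proj₁ Φ₁ Φ₂ = proj₂ Φ₂ Φ₁ ∧ e.inverse ⋙ proj₂ Φ₁ Φ₂ = proj₁ Φ₂ Φ₁ := by
  let fwd : CFP Φ₁ Φ₂ ⥤ CFP Φ₂ Φ₁ :=
    { obj := fun X => ⟨X.snd, X.fst, X.iso.symm⟩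
      map := fun {X Y} f => ⟨f.snd, f.fst, by
        change Φ₂.map f.snd ≫ Y.iso.inv = X.iso.inv ≫ Φ₁.map f.fst
        rw [Iso.comp_inv_eq, Category.assoc, Iso.eq_inv_comp]
        exact f.w.symm⟩
      map_id := fun X => hom_ext rfl rfl
      map_comp := fun f g => hom_ext rfl rfl }
  let bwd : CFP Φ₂ Φ₁ ⥤ CFP Φ₁ Φ₂ :=
    { obj := fun Y => ⟨Y.snd, Y.fst, Y.iso.symm⟩
      map := fun {X Y} f => ⟨f.snd, f.fst, by
        change Φ₁.map f.snd ≫ Y.iso.inv = X.iso.inv ≫ Φ₂.map f.fst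
        rw [Iso.comp_inv_eq, Category.assoc, Iso.eq_inv_comp]
        exact f.w.symm⟩
      map_id := fun X => hom_ext rfl rfl
      map_comp := fun f g => hom_ext rfl rfl }
  let η : 𝟭 (CFP Φ₁ Φ₂) ≅ fwd ⋙ bwd := NatIso.ofComponents (fun X => isoMk (Iso.refl _) (Iso.refl _) (by
      change Φ₁.map (𝟙 _) ≫ X.iso.hom = X.iso.hom ≫ Φ₂.map (𝟙 _)
      rw [Φ₁.map_id, Φ₂.map_id, Category.id_comp, Category.comp_id]))
    (fun {X Y} f => hom_ext
      (by change f.fst ≫ 𝟙 _ = 𝟙 _ ≫ f.fst; rw [Category.comp_id, Category.id_comp])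
      (by change f.snd ≫ 𝟙 _ = 𝟙 _ ≫ f.snd; rw [Category.comp_id, Category.id_comp]))
  let ε : bwd ⋙ fwd ≅ 𝟭 (CFP Φ₂ Φ₁) := NatIso.ofComponents (fun Y => isoMk (Iso.refl _) (Iso.refl _) (by
      change Φ₂.map (𝟙 _) ≫ Y.iso.hom = Y.iso.hom ≫ Φ₁.map (𝟙 _)
      rw [Φ₁.map_id, Φ₂.map_id, Category.id_comp, Category.comp_id]))
    (fun {X Y} f => hom_ext
      (by change f.fst ≫ 𝟙 _ = 𝟙 _ ≫ f.fst; rw [Category.comp_id, Category.id_comp])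
      (by change f.snd ≫ 𝟙 _ = 𝟙 _ ≫ f.snd; rw [Category.comp_id, Category.id_comp]))
  exact ⟨CategoryTheory.Equivalence.mk fwd bwd η ε, rfl, rfl, rfl, rfl⟩

/-! ### Second-corner twins of the first-corner transports -/

/-- **`C₁ ×_D C₂′ ⥲ C₁ ×_D C₂` along an equivalence `E : C₂′ ⥲ C₂` of the SECOND corner** (corner functor
`E ⋙ Φ₂`): over the identity on the first projection and over `E` on the second, on the nose.
[cite: MochizukiFrdI2008, §0 p.17] -/
theorem exists_equivalence_precomp_right {C₂' : Type u₂} [Category.{v₂} C₂'] (Φ₁ : C₁ ⥤ D) (E : C₂' ≌ C₂)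
    (Φ₂ : C₂ ⥤ D) :
    ∃ e : CFP Φ₁ (E.functor ⋙ Φ₂) ≌ CFP Φ₁ Φ₂,
      e.functor ⋙ proj₁ Φ₁ Φ₂ = proj₁ Φ₁ (E.functor ⋙ Φ₂) ∧
        e.functor ⋙ proj₂ Φ₁ Φ₂ = proj₂ Φ₁ (E.functor ⋙ Φ₂) ⋙ E.functor := by
  obtain ⟨s₁, hs₁₁, hs₁₂, -, -⟩ := exists_equivalence_swap Φ₁ (E.functor ⋙ Φ₂)
  obtain ⟨p, hp₁, hp₂⟩ := exists_equivalence_precomp E Φ₂ Φ₁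
  obtain ⟨s₂, hs₂₁, hs₂₂, -, -⟩ := exists_equivalence_swap Φ₂ Φ₁
  refine ⟨s₁.trans (p.trans s₂), ?_, ?_⟩
  · change s₁.functor ⋙ p.functor ⋙ s₂.functor ⋙ proj₁ Φ₁ Φ₂ = _
    rw [hs₂₁, hp₂, hs₁₂]
  · change s₁.functor ⋙ p.functor ⋙ s₂.functor ⋙ proj₂ Φ₁ Φ₂ = _
    rw [hs₂₂, hp₁]
    change (s₁.functor ⋙ proj₁ _ _) ⋙ E.functor = _
    rw [hs₁₁]

/-- **`C₁ ×_D C₂` along an ISOMORPHIC second corner functor `Φ₂ ≅ Φ₂′`**: identity on both projections on the nose.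
[cite: MochizukiFrdI2008, §0 p.17] -/
theorem exists_equivalence_of_iso_right (Φ₁ : C₁ ⥤ D) {Φ₂ Φ₂' : C₂ ⥤ D} (i : Φ₂ ≅ Φ₂') :
    ∃ e : CFP Φ₁ Φ₂ ≌ CFP Φ₁ Φ₂',
      e.functor ⋙ proj₁ Φ₁ Φ₂' = proj₁ Φ₁ Φ₂ ∧ e.functor ⋙ proj₂ Φ₁ Φ₂' = proj₂ Φ₁ Φ₂ := by
  obtain ⟨s₁, hs₁₁, hs₁₂, -, -⟩ := exists_equivalence_swap Φ₁ Φ₂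
  obtain ⟨p, hp₁, hp₂⟩ := exists_equivalence_of_iso_left i Φ₁
  obtain ⟨s₂, hs₂₁, hs₂₂, -, -⟩ := exists_equivalence_swap Φ₂' Φ₁
  refine ⟨s₁.trans (p.trans s₂), ?_, ?_⟩
  · change s₁.functor ⋙ p.functor ⋙ s₂.functor ⋙ proj₁ Φ₁ Φ₂' = _
    rw [hs₂₁, hp₂, hs₁₂]
  · change s₁.functor ⋙ p.functor ⋙ s₂.functor ⋙ proj₂ Φ₁ Φ₂' = _
    rw [hs₂₂, hp₁, hs₁₁]

/-! ### Functoriality in compatible triples of equivalences -/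

/-- **`C₁ ×_D C₂` is functorial in compatible triples of equivalences.**  For equivalences `Ψ₁ : C₁ ⥲ C₁`,
`Θ : C₂ ⥲ C₂`, `Θ_B : D ⥲ D` with 2-cells `σ₁ : Ψ₁ ⋙ Φ₁ ≅ Φ₁ ⋙ Θ_B`, `σ₂ : Θ ⋙ Φ₂ ≅ Φ₂ ⋙ Θ_B`, there is an
equivalence `C₁ ×_D C₂ ⥲ C₁ ×_D C₂` lying over `Ψ₁` on the first projection and over `Θ` on the second, ON THE NOSE
(`(A₁, A₂, α) ↦ (Ψ₁ A₁, Θ A₂, σ₁⁻¹ ∘ Θ_B(α) ∘ σ₂)` up to the bookkeeping isomorphisms): post-compose both corners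
with `Θ_B` (`exists_equivalence_postcomp`), re-glue the corners along `σ₁⁻¹`, `σ₂⁻¹`, pre-compose with `Ψ₁` and `Θ`.
[cite: MochizukiFrdI2008, §0 p.17] -/
theorem exists_equivalence_of_compatible_triple (Φ₁ : C₁ ⥤ D) (Φ₂ : C₂ ⥤ D) (Ψ₁ : C₁ ≌ C₁) (Θ : C₂ ≌ C₂)
    (ΘB : D ≌ D) (σ₁ : Ψ₁.functor ⋙ Φ₁ ≅ Φ₁ ⋙ ΘB.functor) (σ₂ : Θ.functor ⋙ Φ₂ ≅ Φ₂ ⋙ ΘB.functor) :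
    ∃ e : CFP Φ₁ Φ₂ ≌ CFP Φ₁ Φ₂,
      e.functor ⋙ proj₁ Φ₁ Φ₂ = proj₁ Φ₁ Φ₂ ⋙ Ψ₁.functor ∧ e.functor ⋙ proj₂ Φ₁ Φ₂ = proj₂ Φ₁ Φ₂ ⋙ Θ.functor := by
  haveI : ΘB.functor.Full := ΘB.fullyFaithfulFunctor.full
  haveI : ΘB.functor.Faithful := ΘB.fullyFaithfulFunctor.faithful
  -- (1) post-compose both corners with `Θ_B`
  obtain ⟨e₁, h₁₁, h₁₂⟩ := exists_equivalence_postcomp Φ₁ Φ₂ ΘB.functor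
  -- (2) re-glue the first corner along `σ₁⁻¹ : Φ₁ ⋙ Θ_B ≅ Ψ₁ ⋙ Φ₁`
  obtain ⟨e₂, h₂₁, h₂₂⟩ := exists_equivalence_of_iso_left σ₁.symm (Φ₂ ⋙ ΘB.functor)
  -- (3) pre-compose the first corner with `Ψ₁`
  obtain ⟨e₃, h₃₁, h₃₂⟩ := exists_equivalence_precomp Ψ₁ Φ₁ (Φ₂ ⋙ ΘB.functor)
  -- (4) re-glue the second corner along `σ₂⁻¹ : Φ₂ ⋙ Θ_B ≅ Θ ⋙ Φ₂`
  obtain ⟨e₄, h₄₁, h₄₂⟩ := exists_equivalence_of_iso_right Φ₁ (Φ₂ := Φ₂ ⋙ ΘB.functor) σ₂.symm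
  -- (5) pre-compose the second corner with `Θ`
  obtain ⟨e₅, h₅₁, h₅₂⟩ := exists_equivalence_precomp_right Φ₁ Θ Φ₂
  refine ⟨e₁.trans (e₂.trans (e₃.trans (e₄.trans e₅))), ?_, ?_⟩
  · change e₁.functor ⋙ e₂.functor ⋙ e₃.functor ⋙ e₄.functor ⋙ e₅.functor ⋙ proj₁ Φ₁ Φ₂ = _
    rw [h₅₁, h₄₁, h₃₁]
    change (e₁.functor ⋙ e₂.functor ⋙ proj₁ _ _) ⋙ Ψ₁.functor = _
    rw [h₂₁, h₁₁]
  · change e₁.functor ⋙ e₂.functor ⋙ e₃.functor ⋙ e₄.functor ⋙ e₅.functor ⋙ proj₂ Φ₁ Φ₂ = _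
    rw [h₅₂]
    change (e₁.functor ⋙ e₂.functor ⋙ e₃.functor ⋙ e₄.functor ⋙ proj₂ _ _) ⋙ Θ.functor = _
    rw [h₄₂, h₃₂, h₂₂, h₁₂]

end CFP

end Literature.AlgebraicGeometry.Frobenioids
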